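import Literature.AlgebraicGeometry.HodgeTheory.WeilTypeSecondCohomologyK3Type
import HarnessLib

/-!
# The Calabi–Yau-type summand of `Hⁿ(B, ℚ)` of a general abelian `2n`-fold of Weil type: `⋀ⁿ_K H¹(B, ℚ) ⊂ Hⁿ(B, ℚ)` descends to `T₁ ⊕ T₁` with `h^{n,0}(T₁) = 1` iff the discriminant is trivial, and is simple with `h^{n,0} = 2` otherwise (Friedman–Laza 2013 §3.5 Prop. 37, §2.4.2; van Geemen–Rapagnetta 2026 §1.15)

[topic AlgebraicGeometry/HodgeTheory]

Layer `Literature/AlgebraicGeometry/HodgeTheory`; cross-ladder literature-typing layer (D-0088(4), LT-H4, seat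
`hodge-lit-oqh-1` gen 3). Companion of `HodgeTheory/WeilTypeSecondCohomologyK3Type` (no sub-Hodge structure of
K3 type in `H²(B, ℚ)` for general `B` of dimension `2n ≥ 6`): the «opening» named in the same paragraph of
van Geemen–Rapagnetta — "if the discriminant of `B` is trivial, then `Hⁿ(B, ℚ)` does have a sub Hodge structure
`T₁` of CY type, so with `T₁^{n,0} = 1`" — with its REFEREED source, Friedman–Laza's Appendix §3.5, which
also gives the complementary statement for non-trivial discriminant.  One named fact (statement only, D-0014),
proved kernel; HONEST FRAMING: typed ≠ proved ≠ endorsed; nothing here asserts HC / HC_AV / W₆.  For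
SIXFOLDS the trivial-discriminant (split) component is the one where the Hodge–Weil classes ARE known to be
algebraic (Markman 2025, tree record `HodgeTheory.Markman2025_weilClasses_algebraic_hyperbolicSixfold`,
PREPRINT); on the non-split components — the open cells of the ladder — clause (ii) applies.

## Sources (read at source; locators = files of the materialised texts)

* [FriedmanLaza2013] R. Friedman, R. Laza, *Semialgebraic horizontal subvarieties of Calabi–Yau type*, Duke
  Math. J. 162 (2013) 2077–2148 = arXiv:1109.5632 — **REFEREED**; held `paper:arxiv-1109.5632`. Verbatim:
  §3.5 "Appendix" [p0019:L15–L46, p0020:L1–L25], for `E/E₀` an imaginary quadratic extension (`E₀` a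
  subfield of `ℝ`), `U` an `E`-vector space of dimension `2n` with a non-degenerate Hermitian form `ψ`,
  `G = SU(U, ψ)`, `W = ⋀ⁿ_E U`, `⋆ = ρ⁻¹ ∘ τ : W → W` the (`E`-anti-linear) Hodge star: **Lemma 36** "The
  Hodge star operator `⋆ : W → W` commutes with the natural `G`-action on `W` and satisfies
  `⋆⋆ = (-1)ⁿ disc(ψ)·id_W`"; "`Res_{E/E₀} W ⊗_{E₀} E ≅ W ⊕ W̄ ≅ W ⊕ W^∨ ≅ W ⊕ W` as `E[G]`-modules";
  **Prop. 37** "(i) `𝒜 = End_{E₀[G]}(Res_{E/E₀} W)` [`𝒜` = the `E₀`-algebra generated by `E` and `⋆`,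
  `dim_{E₀} 𝒜 = 4`]. (ii) The algebra `𝒜` is semisimple. (iii) `𝒜` is a division algebra ⟺ the
  representation `W` cannot be defined over `E₀`, i.e. ⟺ `Res_{E/E₀} W` is an irreducible `E₀[G]`-module.
  (iv) `𝒜 ≅ 𝕄₂(E₀)` is a matrix algebra ⟺ […] `Res_{E/E₀} W` is a reducible `E₀[G]`-module, or
  equivalently if there exists a `G`-representation on an `E₀`-vector space `W₀` such that `W ≅ W₀ ⊗_{E₀} E`
  as `E[G]`-modules. (v) `𝒜 ≅ 𝕄₂(E₀)` is a matrix algebra ⟺ `(-1)ⁿ disc(ψ)` is a norm in `E₀`" (proof: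
  "if `Res_{E/E₀} W` is a reducible `E₀[G]`-module, then it is necessarily of the form `W₀ ⊕ W₀`"); and
  §2.4.2 "Type `I_{n,n}`" [p0014:L24]: "the domain `I_{n,n}` parameterizes abelian varieties `A` of Weil type
  of dimension `g = 2n` (i.e. abelian varieties with weak CM multiplication by a degree `2` CM field `E` […]
  and such that the induced unitary group is `SU(n,n) ⊂ Sp(2g)`). It is not hard to see that the Hodge
  structure `⋀ⁿ H¹(A)` contains a Hodge substructure of Calabi-Yau type, giving a motivic realization for the
  Hermitian VHS of CY type associated to `I_{n,n}` […] A detailed study of the cases `n = 2, 3` is done in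
  [lombardo] and [filippini] respectively"; §2.3 table [p0012:L28]: "`I_{n,n}` (`A_{2n-1}, α_n`): weight `n`;
  `V_ℂ = ⋀ⁿ S`, where `S` is the standard representation; for `n = 3`, `h^{2,1} = 9`."
* [vanGeemenRapagnetta2026WeilHK] B. van Geemen, A. Rapagnetta, arXiv:2607.18341 (2026) — **PREPRINT** —
  §1.15 [p0013:L48–L50]: "It is maybe interesting to observe that if the discriminant of `B` is trivial, then
  `Hⁿ(B, ℚ)` does have a sub Hodge structure `T₁` of CY type, so with `T₁^{n,0} = 1`, see [CF] for the case
  `n = 3`" (context: "A general abelian variety `B` of Weil type of dimension `2n`"); Thm. 1.8, proof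
  [p0010:L30–L31]: "these subrepresentations [of `smt(B)` over `ℚ`] correspond to sub Hodge structures".
* [Lombardo2001] G. Lombardo, Tohoku Math. J. 53 (2001), §3 Thm. 3.8 — the case `n = 2` (`⋆ = t`, `t² = a`):
  `S = ⋀²_K H¹ ≅ T₊ ⊕ T₋` of K3 type at discriminant one — **REFEREED**; typed WITHOUT genericity in the
  companion file (`Lombardo2001_weilExteriorSquare_K3Type_decomposition_of_hyperbolic`).
* Dictionary (as in the companion file): Lombardo §1, `a = (-1)ⁿ det H`; van Geemen–Rapagnetta Lemma 1.5:
  `(-1)ⁿ disc(ψ) ∈ Nm(K^×)` ⟺ «discriminant trivial» ⟺ HYPERBOLIC = `Motives.IsHyperbolicWeilType`;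
  «general» (`Hg(B) = SU_H`, van Geemen 1994 Thm. 6.11) = `VanGeemen1994.HasHodgeGroupSU`.

## Rendering

For `(A, φ)` of Weil type `(n, d)` (`HodgeTheory.IsWeilType`), `K = ℚ(φ)`, the `K`-symmetrised class
`h_K = d·e^*a + φ^*e^*a` with `Hg(A) = SU_H` (`HasHodgeGroupSU` — so that, by van Geemen–Rapagnetta's
dictionary, the `ℚ`-sub-`Hg`-representations of `Hⁿ(A, ℚ) = ⋀ⁿ_ℚ H¹` are exactly its sub-Hodge structures and
Prop. 37 applies with `G = Hg(A)`, `U = H¹(A, ℚ)`, `ψ = H`), and every Hodge-symmetric Hodge model `M` (the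
weight-`n` structure `HodgeModel.hodgeStructure … n` on `Hⁿ(A(ℂ); ℚ) = Motives.bettiCohomology A.X n`):
(i) if `h_K` is hyperbolic (`(-1)ⁿ disc ∈ Nm`): `Res_{K/ℚ} ⋀ⁿ_K H¹ = W₀ ⊕ W₀` — there are two sub-Hodge
structures `T₁, T₂` of `Hⁿ(A, ℚ)`, with `T₁ ∩ T₂ = 0`, each IRREDUCIBLE of `ℚ`-dimension `C(2n, n)`
(`= dim_E ⋀ⁿ_E U`) with `h^{n,0} = 1` (of the two `(n,0)`-lines `⋀ⁿ V₊^{1,0}`, `⋀ⁿ V₋^{1,0}` of `⋀ⁿ_K H¹`, one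
in each — "CY type"), and a bijective morphism of Hodge structures `T₁ → T₂`; (ii) if `h_K` is NOT hyperbolic:
`Res_{K/ℚ} ⋀ⁿ_K H¹` is an IRREDUCIBLE sub-Hodge structure of `Hⁿ(A, ℚ)` of `ℚ`-dimension `2·C(2n, n)` with
`h^{n,0} = 2`.  The sub-space `⋀ⁿ_K H¹ ⊂ Hⁿ` itself is not given a name on the real carriers here (for
`n ≥ 3` it is not an eigenspace of `φₙ`; the abstract version is `Motives.HodgeStructure.EndAction.weilPowerSub`):
the clauses are existence statements with the printed invariants.  GRADE: PRINT-SYNTHESIS — the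
representation-theoretic content is Friedman–Laza Prop. 37 (REFEREED), the Hodge-theoretic sentence is
Friedman–Laza §2.4.2 ("It is not hard to see") + van Geemen–Rapagnetta §1.15 (PREPRINT) through the standard
dictionary «`ℚ`-sub-`Hg`-representations = sub-Hodge structures»; the `h^{n,0}`-count is the Weil-type
eigenvalue condition (`dim V_±^{1,0} = n`, as in Lombardo's Lemma (2,8,2)); case `n = 2` of (i) = Lombardo
Thm. 3.8 (REFEREED).  NOT here: the identification of `T₁ ⊗ ℂ` with the `SL(2n)`-representation `⋀ⁿ S` and
its full Hodge numbers (`(1, 9, 9, 1)` for `n = 3`, Friedman–Laza §2.3) beyond `h^{n,0}`; [CF]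
(Cacciatori–Filippini, the `E³/ℤ₃` CM point); whether `Hⁿ(A, ℚ)` has OTHER sub-Hodge structures with
`h^{n,0} = 1` outside `⋀ⁿ_K H¹` in case (ii) (not printed).

## References

[FriedmanLaza2013] Duke Math. J. 162 (2013): §2.3 (table, `I_{n,n}`), §2.4.2, §3.5 Lemma 36, Prop. 37;
[vanGeemenRapagnetta2026WeilHK] arXiv:2607.18341: Lemma 1.5, Thm. 1.8 (proof), §1.15; [Lombardo2001] Tohoku
Math. J. 53 (2001): §1, §3 Thm. 3.8; [vanGeemen1994HodgeAV] LNM 1594: Lemma 5.2 (3), Thm. 6.11.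
-/

noncomputable section

open CategoryTheory
open scoped TensorProduct

namespace Literature.AlgebraicGeometry.HodgeTheory

open Literature.AlgebraicTopology.SingularHomology
open Literature.AlgebraicGeometry.Motives (AbelianVariety ProjectiveEmbedding projectiveSpace
  bettiCohomology HodgeStructure IsHyperbolicWeilType)
open Literature.AlgebraicGeometry.Motives.HodgeStructure (SubHodgeStructure)
open Literature.AlgebraicGeometry.VanGeemen1994 (HasHodgeGroupSU)

section HodgeTheory

/-- **Friedman–Laza 2013, §3.5 Prop. 37 with Lemma 36 and §2.4.2 (= van Geemen–Rapagnetta 2026 §1.15, last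
sentence; `n = 2`: Lombardo 2001 Thm. 3.8): the summand `⋀ⁿ_K H¹(A, ℚ)` of the middle cohomology `Hⁿ(A, ℚ)`
of a GENERAL abelian `2n`-fold of Weil type splits as `T₁ ⊕ T₁` with `T₁` irreducible of Calabi–Yau type
(`h^{n,0}(T₁) = 1`, `dim_ℚ T₁ = C(2n,n)`) when the discriminant is trivial, and is irreducible with
`h^{n,0} = 2` (`dim_ℚ = 2·C(2n,n)`) otherwise** ("`𝒜 ≅ 𝕄₂(E₀)` […] ⟺ `Res_{E/E₀} W` is a reducible
`E₀[G]`-module [then "necessarily of the form `W₀ ⊕ W₀`"] ⟺ `(-1)ⁿ disc(ψ)` is a norm"; "`𝒜` is a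
division algebra ⟺ `Res_{E/E₀} W` is an irreducible `E₀[G]`-module"; "`⋀ⁿ H¹(A)` contains a Hodge
substructure of Calabi-Yau type"; vGR: "if the discriminant of `B` is trivial, then `Hⁿ(B, ℚ)` does have a
sub Hodge structure `T₁` of CY type, so with `T₁^{n,0} = 1`").  Rendering and GRADE (PRINT-SYNTHESIS; REFEREED
ingredients): module docstring — `(A, φ)` of Weil type `(n, d)`, `h_K = d·e^*a + φ^*e^*a` with `Hg = SU_H`
(`HasHodgeGroupSU`), every Hodge-symmetric model: (i) `h_K` hyperbolic ⟹ two disjoint irreducible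
sub-Hodge structures `T₁, T₂` of `Hⁿ(A, ℚ)` of dimension `C(2n,n)` with `h^{n,0} = 1` and a bijective
morphism `T₁ → T₂`; (ii) `h_K` not hyperbolic ⟹ an irreducible sub-Hodge structure of dimension `2·C(2n,n)`
with `h^{n,0} = 2`.  Users take `(h : FriedmanLaza2013_CYType_subHodgeStructure_middleCohomology_generalWeilType)`.
[cite: FriedmanLaza2013, §3.5 Lemma 36 and Prop. 37 (i)–(v) (arXiv p0019:L46–p0020:L25); §2.4.2 (p0014:L24); §2.3 table (p0012:L28)]
[cite: vanGeemenRapagnetta2026WeilHK, §1.15 (p. 13, L48–L50) and proof of Thm. 1.8 (p. 10, L30–L31)]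
[cite: Lombardo2001, §3 Thm. 3.8 (n = 2)] [cite: vanGeemen1994HodgeAV, Lemma 5.2 (3) and Thm. 6.11] -/
def FriedmanLaza2013_CYType_subHodgeStructure_middleCohomology_generalWeilType : Prop :=
  ∀ (A : AbelianVariety ℂ) (φ : A ⟶ A) (n d : ℕ) (e : ProjectiveEmbedding A.X)
    (a : complexBetti (projectiveSpace e.n ℂ) 2),
    IsWeilType A φ n d → IsRationalClass a → a ≠ 0 →
    HasHodgeGroupSU A φ n d
      ((d : ℂ) • complexBetti.map e.ι 2 a + complexBetti.map φ.hom.hom.hom 2 (complexBetti.map e.ι 2 a)) →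
    ∀ (M : HodgeModel A.dim A.X) (hM : M.IsHodgeSymmetric),
      (IsHyperbolicWeilType A φ n
          ((d : ℂ) • complexBetti.map e.ι 2 a + complexBetti.map φ.hom.hom.hom 2 (complexBetti.map e.ι 2 a)) →
        ∃ T₁ T₂ : SubHodgeStructure (M.hodgeStructure Motives.AbelianVariety.isSmoothProjective_holds hM n),
          T₁.toSubmodule ⊓ T₂.toSubmodule = ⊥ ∧
            T₁.toHodgeStructure.IsIrreducible ∧ T₂.toHodgeStructure.IsIrreducible ∧
              Module.finrank ℚ T₁.toSubmodule = (2 * n).choose n ∧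
                Module.finrank ℚ T₂.toSubmodule = (2 * n).choose n ∧
                  T₁.toHodgeStructure.hodgeNumber n 0 = 1 ∧ T₂.toHodgeStructure.hodgeNumber n 0 = 1 ∧
                    ∃ f : HodgeStructure.Hom T₁.toHodgeStructure T₂.toHodgeStructure,
                      Function.Bijective f.toLinearMap) ∧
      (¬ IsHyperbolicWeilType A φ n
          ((d : ℂ) • complexBetti.map e.ι 2 a + complexBetti.map φ.hom.hom.hom 2 (complexBetti.map e.ι 2 a)) →
        ∃ T : SubHodgeStructure (M.hodgeStructure Motives.AbelianVariety.isSmoothProjective_holds hM n),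
          T.toHodgeStructure.IsIrreducible ∧ Module.finrank ℚ T.toSubmodule = 2 * (2 * n).choose n ∧
            T.toHodgeStructure.hodgeNumber n 0 = 2)

/-! ### Kernel -/

variable {A : AbelianVariety ℂ} {φ : A ⟶ A} {n d : ℕ}

/-- **Trivial discriminant: a Calabi–Yau-type sub-Hodge structure of `Hⁿ(A, ℚ)` EXISTS** (general member) —
the «opening» of van Geemen–Rapagnetta §1.15. [cite: FriedmanLaza2013, §3.5 Prop. 37 (iv)–(v) and §2.4.2]
[cite: vanGeemenRapagnetta2026WeilHK, §1.15] -/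
theorem FriedmanLaza2013_CYType_subHodgeStructure_middleCohomology_generalWeilType.exists_of_hyperbolic
    (h : FriedmanLaza2013_CYType_subHodgeStructure_middleCohomology_generalWeilType)
    (e : ProjectiveEmbedding A.X) {a : complexBetti (projectiveSpace e.n ℂ) 2}
    (hW : IsWeilType A φ n d) (ha : IsRationalClass a) (ha0 : a ≠ 0)
    (hSU : HasHodgeGroupSU A φ n d
      ((d : ℂ) • complexBetti.map e.ι 2 a + complexBetti.map φ.hom.hom.hom 2 (complexBetti.map e.ι 2 a)))
    (hh : IsHyperbolicWeilType A φ n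
      ((d : ℂ) • complexBetti.map e.ι 2 a + complexBetti.map φ.hom.hom.hom 2 (complexBetti.map e.ι 2 a)))
    (M : HodgeModel A.dim A.X) (hM : M.IsHodgeSymmetric) :
    ∃ T : SubHodgeStructure (M.hodgeStructure Motives.AbelianVariety.isSmoothProjective_holds hM n),
      T.toHodgeStructure.IsIrreducible ∧ Module.finrank ℚ T.toSubmodule = (2 * n).choose n ∧
        T.toHodgeStructure.hodgeNumber n 0 = 1 := by
  obtain ⟨T₁, -, -, h1, -, hd1, -, h10, -, -⟩ := (h A φ n d e a hW ha ha0 hSU M hM).1 hh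
  exact ⟨T₁, h1, hd1, h10⟩

/-- **SIXFOLDS, trivial discriminant (= the SPLIT component, `det H = -1`; the component where the Hodge–Weil
classes are known to be algebraic, Markman 2025)**: for a general split abelian sixfold of Weil type,
`H³(A, ℚ)` contains an irreducible sub-Hodge structure `T₁` of Calabi–Yau threefold type — `h^{3,0}(T₁) = 1`,
`dim_ℚ T₁ = C(6,3) = 20` (Hodge numbers `(1, 9, 9, 1)` in print) — the structure van Geemen–Rapagnetta propose
as the sixfold substitute for the K3-type `T ⊂ H²` of fourfolds. [cite: FriedmanLaza2013, §2.3 (I_{3,3}: h^{2,1} = 9) and §2.4.2]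
[cite: vanGeemenRapagnetta2026WeilHK, §1.15 ("see [CF] for the case n = 3")] -/
theorem FriedmanLaza2013_CYType_subHodgeStructure_middleCohomology_generalWeilType.exists_sixfold_split
    (h : FriedmanLaza2013_CYType_subHodgeStructure_middleCohomology_generalWeilType)
    (e : ProjectiveEmbedding A.X) {a : complexBetti (projectiveSpace e.n ℂ) 2}
    (hW : IsWeilType A φ 3 d) (ha : IsRationalClass a) (ha0 : a ≠ 0)
    (hSU : HasHodgeGroupSU A φ 3 d
      ((d : ℂ) • complexBetti.map e.ι 2 a + complexBetti.map φ.hom.hom.hom 2 (complexBetti.map e.ι 2 a)))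
    (hh : IsHyperbolicWeilType A φ 3
      ((d : ℂ) • complexBetti.map e.ι 2 a + complexBetti.map φ.hom.hom.hom 2 (complexBetti.map e.ι 2 a)))
    (M : HodgeModel A.dim A.X) (hM : M.IsHodgeSymmetric) :
    ∃ T : SubHodgeStructure (M.hodgeStructure Motives.AbelianVariety.isSmoothProjective_holds hM 3),
      T.toHodgeStructure.IsIrreducible ∧ Module.finrank ℚ T.toSubmodule = 20 ∧
        T.toHodgeStructure.hodgeNumber 3 0 = 1 := by
  obtain ⟨T, h1, hd, h30⟩ := h.exists_of_hyperbolic e hW ha ha0 hSU hh M hM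
  exact ⟨T, h1, by rw [hd]; decide, by exact_mod_cast h30⟩

/-- **SIXFOLDS, non-trivial discriminant (the NON-SPLIT components — the open cells of the ladder)**: for a
general non-split abelian sixfold of Weil type, `H³(A, ℚ)` contains an irreducible sub-Hodge structure of
`ℚ`-dimension `40 = 2·C(6,3)` with `h^{3,0} = 2` (`= ⋀³_K H¹`, which therefore does NOT split off a CY-type
piece). [cite: FriedmanLaza2013, §3.5 Prop. 37 (iii), (v)] [cite: vanGeemenRapagnetta2026WeilHK, §1.15] -/
theorem FriedmanLaza2013_CYType_subHodgeStructure_middleCohomology_generalWeilType.exists_sixfold_nonsplit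
    (h : FriedmanLaza2013_CYType_subHodgeStructure_middleCohomology_generalWeilType)
    (e : ProjectiveEmbedding A.X) {a : complexBetti (projectiveSpace e.n ℂ) 2}
    (hW : IsWeilType A φ 3 d) (ha : IsRationalClass a) (ha0 : a ≠ 0)
    (hSU : HasHodgeGroupSU A φ 3 d
      ((d : ℂ) • complexBetti.map e.ι 2 a + complexBetti.map φ.hom.hom.hom 2 (complexBetti.map e.ι 2 a)))
    (hnh : ¬ IsHyperbolicWeilType A φ 3
      ((d : ℂ) • complexBetti.map e.ι 2 a + complexBetti.map φ.hom.hom.hom 2 (complexBetti.map e.ι 2 a)))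
    (M : HodgeModel A.dim A.X) (hM : M.IsHodgeSymmetric) :
    ∃ T : SubHodgeStructure (M.hodgeStructure Motives.AbelianVariety.isSmoothProjective_holds hM 3),
      T.toHodgeStructure.IsIrreducible ∧ Module.finrank ℚ T.toSubmodule = 40 ∧
        T.toHodgeStructure.hodgeNumber 3 0 = 2 := by
  obtain ⟨T, h1, hd, h30⟩ := (h A φ 3 d e a hW ha ha0 hSU M hM).2 hnh
  exact ⟨T, h1, by rw [hd]; decide, by exact_mod_cast h30⟩

/-- The printed numbers: `dim_ℚ T₁ = C(2n, n)` (`6` for fourfolds — Lombardo's `T` of type `(1,4,1)` —, `20`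
for sixfolds, of Hodge numbers `(1, 9, 9, 1)`), `dim_ℚ ⋀ⁿ_K H¹ = 2·C(2n, n)` inside `bₙ = C(4n, n)`.
[cite: FriedmanLaza2013, §2.3 table] [cite: Lombardo2001, §3 Cor. (type (1,4,1))] -/
example : Nat.choose 4 2 = 6 ∧ 1 + 4 + 1 = 6 ∧ Nat.choose 6 3 = 20 ∧ 1 + 9 + 9 + 1 = 20 ∧
    2 * Nat.choose 6 3 = 40 ∧ 40 ≤ Nat.choose 12 3 ∧ Nat.choose 12 3 = 220 := by
  decide

end HodgeTheory

end Literature.AlgebraicGeometry.HodgeTheory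

end
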